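import Summits.NavierStokesRegularity.FunctionalMining.BiaxialContact
import Summits.NavierStokesRegularity.FunctionalMining.TopEigGapCoerciveSimpleAux
import Summits.NavierStokesRegularity.FunctionalMining.TopEigHeatDanskin
import HarnessLib

/-!
# FunctionalMining / NoGo — K54: FRAME SPREAD for (F2) witnesses on `T³`
# `∫ (λ₁ − eᵀSe) = Φ₁(v)` and `(3 − ε) · ∫_{ε-aligned with e} λ₁ ≤ 2 Φ₁(v)` for EVERY fixed direction `e`

HONEST FRAMING. Search for candidate a priori estimates; no regularity claim. Nothing about
Navier–Stokes is proved or asserted in this file. Cell `pub-nsfunc`, no-go seat (gen 51, touch 4).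
Static calculus of smooth fields on the flat torus (no heat flow enters: the statements are
constraints on the SHAPE of a killing family, to be read together with K53/K53b/K53c).

CONTEXT. Door (b)/(F2) of `NOGO.md` is the WANTED kernel negation `¬ TopEigHeatCoercivePos q` of
the open node Lemma L-λ(q) (a KILLING FAMILY `v_n` with `heatDissipation Φ_q v_n / Φ_q v_n → 0`,
`Φ_q = torusTopEigMoment q = ∫ (λ₁⁺)^q`, `λ₁ = torusStrainTopEig v`). The design rules so far say a
killing family is FLAT ((R12), K53b: `Φ_{q/2}² / Φ_q → 1`, i.e. `λ₁ → const =: m` in mean square),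
TORUS-FILLING ((R12′), K53c: `vol{λ₁ > 0} → 1`) and ISO-TOP-like ((R11), K53). This file adds the
constraint coming from the ZERO MEAN OF THE STRAIN over the torus (`∫_{T³} Sᵢⱼ = 0`, tree
`TopEig.integral_strainEntry_eq_zero`): the top eigen-direction cannot stay near ANY fixed axis.

CONTENT (`v` smooth on `T³ = UnitAddTorus (Fin 3)`, `e : Fin 3 → ℝ`; `eᵀS(x)e` is the tree's
Rayleigh sum `∑ᵢⱼ eᵢ S(v)(x)ᵢⱼ eⱼ = quad (strainFlat v x) e`).
§ 1 ZERO MEAN: **`integral_quadStrain_eq_zero`** `∫ eᵀS(x)e dx = 0` (every `e`).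
§ 2 MISALIGNMENT = FULL MASS: for a unit `e`, pointwise `0 ≤ λ₁ − eᵀSe ≤ 3λ₁` (Rayleigh,
`λ₃ ≥ −2λ₁`, divergence free; tree `BiaxialEikonal.quadStrain_le_top`,
`neg_two_mul_top_le_quadStrain`) and **`integral_topEig_sub_quadStrain_eq_moment`**
`∫ (λ₁ − eᵀSe) = Φ₁(v)`: the `λ₁`-weighted average of the normalised Rayleigh defect
`(λ₁ − eᵀSe)/λ₁ ∈ [0, 3]` equals exactly `1`, for EVERY direction `e`.
§ 3 FRAME SPREAD: with the `ε`-ALIGNED SET `alignedSet v e ε = {x | (1 − ε) λ₁(x) ≤ eᵀS(x)e}`,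
**`spread`** `(3 − ε) · ∫_{alignedSet} λ₁ ≤ 2 · ∫ λ₁ = 2 Φ₁(v)` and **`spread_compl`**
`(1 − ε) Φ₁(v) ≤ (3 − ε) · ∫_{alignedSetᶜ} λ₁`; at `ε = 0`: the contact set `{eᵀSe = λ₁}` (where `e`
IS a top eigenvector) carries at most `2/3` of the top-strain mass and the strictly misaligned set
`{eᵀSe < λ₁}` at least `1/3` (**`three_mul_setIntegral_contact_le`**,
**`moment_le_three_mul_setIntegral_offContact`**); § 4 the plateau reading
**`plateau_aligned_measureReal_le`**: if `m ≤ λ₁` on a measurable `B` then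
`(3 − ε) · m · vol(alignedSet ∩ B) ≤ 2 Φ₁(v)` (`ε ≤ 3`); § 5 FIXED-AXIS RIGIDITY
**`moment_one_eq_zero_of_aligned_everywhere`**: `ε`-aligned everywhere for some `ε < 1` forces
`Φ₁(v) = 0`.

MEANING FOR (F2) (design rule (R13), records only). FRAME SPREAD: along a killing family (flat:
`λ₁ ≈ m` on a plateau `B_n`, `vol B_n → 1`, `Φ₁ ≈ m`), for EVERY fixed axis `e` the set where the
top eigen-direction is `ε`-aligned with `e` (Rayleigh defect `< ε λ₁`) has measure
`≤ 2/(3 − ε) + o(1)`, and on measure `≥ (1 − ε)/(3 − ε) − o(1)` the top frame is tilted against `e`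
by a defect `≥ ε λ₁`: the top eigenframe ROTATES through an `O(1)` solid angle on an `O(1)` fraction
of `T³` while `λ₁` stays `≈ m` — every design with a (nearly) fixed top axis is dead (consistent
with the recorded deaths of the laminate / director / planar classes, K35–K40, Biaxial*). What a
rotation at constant `λ₁` costs in `heatDissipation Φ_q` is the FRAME COST (pen, `SIEVELD.md`
§3.4b; not kernelised): it vanishes only where the frame is parallel or the gap `λ₁ − λ₂` closes —
hence heuristic (R13′, pen, NOT a claim): killing families must be asymptotically UNIAXIAL-PROLATE
(`λ₂ → λ₁`) on the turning set. Nothing here bounds `heatDissipation` for a general field, so (F2)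
stays WANTED/OPEN. [ours = assembly and the spread inequality; folklore = Rayleigh bounds,
zero mean of derivatives of periodic functions]
FILING (prove seat g29, REQUEST #82): declarations byte-identical to the no-go seat's staged `TopEigFrameSpread.STAGING.lean` a00c099b857b8052; this line is the only addition (cut from the v2 docstring-only restage).
-/

noncomputable section

open MeasureTheory Set Filter Topology

namespace Summit.NavierStokesRegularity.FunctionalMining
open Literature.Analysis Literature.Analysis.FunctionSpaces Literature.Analysis.FunctionSpaces.Torus
  Literature.Analysis.FluidPDE TopEig BiaxialEikonal

namespace TopEig

namespace FrameSpread

variable {v : UnitAddTorus (Fin 3) → EuclideanSpace ℝ (Fin 3)}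

/-! ## 1. Zero mean of the Rayleigh sum of a fixed direction -/

/-- Continuity of a strain entry `x ↦ S(v)(x)ᵢⱼ`. [folklore] -/
theorem continuous_strainEntry (hv : Torus.IsSmooth v) (i j : Fin 3) :
    Continuous fun x => torusStrainMatrix v x i j := by
  simp only [torusStrainMatrix, Matrix.of_apply]
  exact (((hv.partialDeriv j).apply i).continuous.add ((hv.partialDeriv i).apply j).continuous).div_const 2

/-- Continuity of the Rayleigh sum `x ↦ eᵀ S(v)(x) e`. [folklore] -/
theorem continuous_quadStrain (hv : Torus.IsSmooth v) (e : Fin 3 → ℝ) :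
    Continuous fun x => ∑ i, ∑ j, e i * torusStrainMatrix v x i j * e j :=
  continuous_finsetSum _ fun i _ => continuous_finsetSum _ fun j _ =>
    (continuous_const.mul (continuous_strainEntry hv i j)).mul continuous_const

/-- Integrability of the Rayleigh sum. [folklore] -/
theorem integrable_quadStrain (hv : Torus.IsSmooth v) (e : Fin 3 → ℝ) :
    Integrable (fun x => ∑ i, ∑ j, e i * torusStrainMatrix v x i j * e j) :=
  (continuous_quadStrain hv e).integrable_unitAddTorus

/-- **ZERO MEAN.** `∫_{T³} eᵀ S(v)(x) e dx = 0` for every smooth field `v` and every `e`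
(each strain entry is a sum of derivatives of periodic functions, tree
`TopEig.integral_strainEntry_eq_zero`). [ours, bookkeeping; folklore] -/
theorem integral_quadStrain_eq_zero (hv : Torus.IsSmooth v) (e : Fin 3 → ℝ) :
    ∫ x, ∑ i, ∑ j, e i * torusStrainMatrix v x i j * e j = 0 := by
  have hint : ∀ i j : Fin 3, Integrable (fun x => e i * torusStrainMatrix v x i j * e j) := fun i j =>
    (((continuous_strainEntry hv i j).integrable_unitAddTorus).const_mul (e i)).mul_const (e j)
  rw [integral_finsetSum _ fun i _ => integrable_finsetSum _ fun j _ => hint i j]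
  refine Finset.sum_eq_zero fun i _ => ?_
  rw [integral_finsetSum _ fun j _ => hint i j]
  refine Finset.sum_eq_zero fun j _ => ?_
  rw [integral_mul_const, integral_const_mul, integral_strainEntry_eq_zero hv i j, mul_zero, zero_mul]

/-- The same in the tree's `quad`/`strainFlat` notation: `∫ quad (strainFlat v x) e dx = 0`. [ours] -/
theorem integral_quad_strainFlat_eq_zero (hv : Torus.IsSmooth v) (e : Fin 3 → ℝ) :
    ∫ x, quad (StrainL4.strainFlat v x) e = 0 := by
  simp only [quad_strainFlat_eq]
  exact integral_quadStrain_eq_zero hv e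

/-! ## 2. Misalignment = full mass -/

/-- Pointwise sandwich `0 ≤ λ₁(x) − eᵀS(x)e` for a unit `e` (Rayleigh). [folklore] -/
theorem topEig_sub_quadStrain_nonneg (x : UnitAddTorus (Fin 3)) {e : Fin 3 → ℝ} (he : e ⬝ᵥ e = 1) :
    0 ≤ torusStrainTopEig v x - ∑ i, ∑ j, e i * torusStrainMatrix v x i j * e j :=
  sub_nonneg.mpr (quadStrain_le_top v x he)

/-- Pointwise sandwich `λ₁(x) − eᵀS(x)e ≤ 3 λ₁(x)` for a unit `e` on a divergence-free field
(`eᵀSe ≥ λ₃ ≥ −2λ₁`). [folklore] -/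
theorem topEig_sub_quadStrain_le (hv : Torus.IsSmooth v) (hdiv : Torus.IsDivFree v)
    (x : UnitAddTorus (Fin 3)) {e : Fin 3 → ℝ} (he : e ⬝ᵥ e = 1) :
    torusStrainTopEig v x - ∑ i, ∑ j, e i * torusStrainMatrix v x i j * e j ≤
      3 * torusStrainTopEig v x := by
  have h := neg_two_mul_top_le_quadStrain (d := Fin 3) (by simp) hv hdiv x he
  linarith

/-- `Φ₁(v) = ∫ λ₁` on divergence-free fields (`λ₁ ≥ 0`). [ours, bookkeeping] -/
theorem topEigMoment_one_eq_integral (hv : Torus.IsSmooth v) (hdiv : Torus.IsDivFree v) :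
    torusTopEigMoment 1 v = ∫ x, torusStrainTopEig v x := by
  unfold torusTopEigMoment
  refine integral_congr_ae (ae_of_all _ fun x => ?_)
  simp only [Real.rpow_one]
  exact max_eq_left (torusStrainTopEig_nonneg (d := Fin 3) (by simp) hv hdiv x)

/-- **MISALIGNMENT IDENTITY.** `∫ (λ₁ − eᵀSe) = ∫ λ₁` for every smooth `v` and every `e`. [ours] -/
theorem integral_topEig_sub_quadStrain_eq (hv : Torus.IsSmooth v) (e : Fin 3 → ℝ) :
    ∫ x, (torusStrainTopEig v x - ∑ i, ∑ j, e i * torusStrainMatrix v x i j * e j) =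
      ∫ x, torusStrainTopEig v x := by
  rw [integral_sub (continuous_torusStrainTopEig hv).integrable_unitAddTorus (integrable_quadStrain hv e),
    integral_quadStrain_eq_zero hv e, sub_zero]

/-- **MISALIGNMENT = FULL MASS**: `∫ (λ₁ − eᵀSe) = Φ₁(v)` on divergence-free fields — with the
sandwich `0 ≤ λ₁ − eᵀSe ≤ 3λ₁` (unit `e`): the `λ₁`-weighted mean of the normalised Rayleigh defect
`(λ₁ − eᵀSe)/λ₁ ∈ [0, 3]` is exactly `1`, whatever the direction `e`. [ours] -/
theorem integral_topEig_sub_quadStrain_eq_moment (hv : Torus.IsSmooth v) (hdiv : Torus.IsDivFree v)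
    (e : Fin 3 → ℝ) :
    ∫ x, (torusStrainTopEig v x - ∑ i, ∑ j, e i * torusStrainMatrix v x i j * e j) =
      torusTopEigMoment 1 v := by
  rw [integral_topEig_sub_quadStrain_eq hv e, topEigMoment_one_eq_integral hv hdiv]

/-! ## 3. Frame spread -/

/-- The `ε`-ALIGNED SET of the direction `e`: where the Rayleigh defect `λ₁ − eᵀSe` is at most
`ε λ₁`, i.e. `(1 − ε) λ₁(x) ≤ eᵀ S(x) e`; at `ε = 0` it is the contact set `{eᵀSe = λ₁}` (for a unit
`e`: `e` is a top eigenvector of `S(x)`). [ours] -/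
def alignedSet (v : UnitAddTorus (Fin 3) → EuclideanSpace ℝ (Fin 3)) (e : Fin 3 → ℝ) (ε : ℝ) :
    Set (UnitAddTorus (Fin 3)) :=
  {x | (1 - ε) * torusStrainTopEig v x ≤ ∑ i, ∑ j, e i * torusStrainMatrix v x i j * e j}

/-- The `ε`-aligned set is measurable (closed). [ours, bookkeeping] -/
theorem measurableSet_alignedSet (hv : Torus.IsSmooth v) (e : Fin 3 → ℝ) (ε : ℝ) :
    MeasurableSet (alignedSet v e ε) :=
  measurableSet_le (continuous_const.mul (continuous_torusStrainTopEig hv)).measurable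
    (continuous_quadStrain hv e).measurable

/-- **FRAME SPREAD.** For a smooth divergence-free `v` on `T³`, a unit direction `e` and any real
`ε`: `(3 − ε) · ∫_{alignedSet v e ε} λ₁ ≤ 2 · ∫ λ₁`. Proof: `0 = ∫ eᵀSe = ∫_A + ∫_{Aᶜ}` with
`eᵀSe ≥ (1 − ε)λ₁` on `A` and `eᵀSe ≥ −2λ₁` on `Aᶜ`. [ours] -/
theorem spread (hv : Torus.IsSmooth v) (hdiv : Torus.IsDivFree v) {e : Fin 3 → ℝ}
    (he : e ⬝ᵥ e = 1) (ε : ℝ) :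
    (3 - ε) * ∫ x in alignedSet v e ε, torusStrainTopEig v x ≤ 2 * ∫ x, torusStrainTopEig v x := by
  have hAm : MeasurableSet (alignedSet v e ε) := measurableSet_alignedSet hv e ε
  have hQi : Integrable (fun x => ∑ i, ∑ j, e i * torusStrainMatrix v x i j * e j) :=
    integrable_quadStrain hv e
  have hLi : Integrable (torusStrainTopEig v) := (continuous_torusStrainTopEig hv).integrable_unitAddTorus
  have h0 := integral_quadStrain_eq_zero hv e
  have hsplit := integral_add_compl hAm hQi
  have hLsplit := integral_add_compl hAm hLi
  have hA : ∫ x in alignedSet v e ε, (1 - ε) * torusStrainTopEig v x ≤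
      ∫ x in alignedSet v e ε, ∑ i, ∑ j, e i * torusStrainMatrix v x i j * e j :=
    setIntegral_mono_on (hLi.const_mul _).integrableOn hQi.integrableOn hAm fun x hx => hx
  have hAc : ∫ x in (alignedSet v e ε)ᶜ, -2 * torusStrainTopEig v x ≤
      ∫ x in (alignedSet v e ε)ᶜ, ∑ i, ∑ j, e i * torusStrainMatrix v x i j * e j :=
    setIntegral_mono_on (hLi.const_mul _).integrableOn hQi.integrableOn hAm.compl fun x _ =>
      neg_two_mul_top_le_quadStrain (d := Fin 3) (by simp) hv hdiv x he
  rw [integral_const_mul] at hA hAc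
  have key : (3 - ε) * ∫ x in alignedSet v e ε, torusStrainTopEig v x =
      (1 - ε) * (∫ x in alignedSet v e ε, torusStrainTopEig v x) +
        2 * ∫ x in alignedSet v e ε, torusStrainTopEig v x := by ring
  rw [key]
  linarith

/-- Ratio form (`ε < 3`): `∫_{alignedSet} λ₁ ≤ 2/(3 − ε) · ∫ λ₁`. [ours] -/
theorem setIntegral_aligned_le (hv : Torus.IsSmooth v) (hdiv : Torus.IsDivFree v) {e : Fin 3 → ℝ}
    (he : e ⬝ᵥ e = 1) {ε : ℝ} (hε : ε < 3) :
    ∫ x in alignedSet v e ε, torusStrainTopEig v x ≤ 2 / (3 - ε) * ∫ x, torusStrainTopEig v x := by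
  rw [show 2 / (3 - ε) * ∫ x, torusStrainTopEig v x = (2 * ∫ x, torusStrainTopEig v x) / (3 - ε) by
    ring, le_div_iff₀ (sub_pos.mpr hε), mul_comm]
  exact spread hv hdiv he ε

/-- **FRAME SPREAD, complement form.** `(1 − ε) · ∫ λ₁ ≤ (3 − ε) · ∫_{(alignedSet v e ε)ᶜ} λ₁`: on the
set where the direction `e` is tilted against the top frame by a Rayleigh defect `> ε λ₁` sits at
least the fraction `(1 − ε)/(3 − ε)` of the top-strain mass. [ours] -/
theorem spread_compl (hv : Torus.IsSmooth v) (hdiv : Torus.IsDivFree v) {e : Fin 3 → ℝ}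
    (he : e ⬝ᵥ e = 1) (ε : ℝ) :
    (1 - ε) * ∫ x, torusStrainTopEig v x ≤
      (3 - ε) * ∫ x in (alignedSet v e ε)ᶜ, torusStrainTopEig v x := by
  have hAm : MeasurableSet (alignedSet v e ε) := measurableSet_alignedSet hv e ε
  have hLi : Integrable (torusStrainTopEig v) := (continuous_torusStrainTopEig hv).integrable_unitAddTorus
  have h := spread hv hdiv he ε
  have hLsplit := integral_add_compl hAm hLi
  have hb : ∫ x in (alignedSet v e ε)ᶜ, torusStrainTopEig v x =
      (∫ x, torusStrainTopEig v x) - ∫ x in alignedSet v e ε, torusStrainTopEig v x := by linarith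
  rw [hb, show (3 - ε) * ((∫ x, torusStrainTopEig v x) - ∫ x in alignedSet v e ε, torusStrainTopEig v x)
      = 3 * (∫ x, torusStrainTopEig v x) - ε * (∫ x, torusStrainTopEig v x)
        - (3 - ε) * ∫ x in alignedSet v e ε, torusStrainTopEig v x by ring,
    show (1 - ε) * ∫ x, torusStrainTopEig v x =
      (∫ x, torusStrainTopEig v x) - ε * ∫ x, torusStrainTopEig v x by ring]
  linarith

/-- **At most two thirds on the contact set** (`ε = 0`): `3 · ∫_{{λ₁ ≤ eᵀSe}} λ₁ ≤ 2 Φ₁(v)`; for a unit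
`e` the set `{λ₁ ≤ eᵀSe}` is the contact set `{eᵀSe = λ₁}` where `e` is a top eigenvector. [ours] -/
theorem three_mul_setIntegral_contact_le (hv : Torus.IsSmooth v) (hdiv : Torus.IsDivFree v)
    {e : Fin 3 → ℝ} (he : e ⬝ᵥ e = 1) :
    3 * ∫ x in {x | torusStrainTopEig v x ≤ ∑ i, ∑ j, e i * torusStrainMatrix v x i j * e j},
      torusStrainTopEig v x ≤ 2 * torusTopEigMoment 1 v := by
  have h := spread hv hdiv he 0
  have hset : alignedSet v e 0 =
      {x | torusStrainTopEig v x ≤ ∑ i, ∑ j, e i * torusStrainMatrix v x i j * e j} := by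
    ext x; simp [alignedSet]
  rw [hset] at h
  rw [topEigMoment_one_eq_integral hv hdiv]
  norm_num at h
  exact h

/-- **At least one third strictly off contact** (`ε = 0`): `Φ₁(v) ≤ 3 · ∫_{{eᵀSe < λ₁}} λ₁`. [ours] -/
theorem moment_le_three_mul_setIntegral_offContact (hv : Torus.IsSmooth v) (hdiv : Torus.IsDivFree v)
    {e : Fin 3 → ℝ} (he : e ⬝ᵥ e = 1) :
    torusTopEigMoment 1 v ≤ 3 * ∫ x in {x | ∑ i, ∑ j, e i * torusStrainMatrix v x i j * e j <
      torusStrainTopEig v x}, torusStrainTopEig v x := by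
  have h := spread_compl hv hdiv he 0
  have hset : (alignedSet v e 0)ᶜ =
      {x | ∑ i, ∑ j, e i * torusStrainMatrix v x i j * e j < torusStrainTopEig v x} := by
    ext x; simp [alignedSet, not_le]
  rw [hset] at h
  rw [topEigMoment_one_eq_integral hv hdiv]
  norm_num at h
  exact h

/-! ## 4. The plateau reading -/

/-- **PLATEAU READING.** If `m ≤ λ₁` on a measurable set `B` (a plateau of the top eigenvalue) then,
for a unit `e` and `ε ≤ 3`, `(3 − ε) · m · vol(alignedSet v e ε ∩ B) ≤ 2 Φ₁(v)`: on a flat field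
(`λ₁ ≈ m` on `B`, `vol B ≈ 1`, `Φ₁ ≈ m`) the `ε`-aligned set of EVERY direction has measure
`≲ 2/(3 − ε)`. [ours] -/
theorem plateau_aligned_measureReal_le (hv : Torus.IsSmooth v) (hdiv : Torus.IsDivFree v)
    {e : Fin 3 → ℝ} (he : e ⬝ᵥ e = 1) {ε : ℝ} (hε : ε ≤ 3) {B : Set (UnitAddTorus (Fin 3))}
    (hB : MeasurableSet B) {m : ℝ} (hm : ∀ x ∈ B, m ≤ torusStrainTopEig v x) :
    (3 - ε) * (m * volume.real (alignedSet v e ε ∩ B)) ≤ 2 * torusTopEigMoment 1 v := by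
  have hAm : MeasurableSet (alignedSet v e ε) := measurableSet_alignedSet hv e ε
  have hLi : Integrable (torusStrainTopEig v) := (continuous_torusStrainTopEig hv).integrable_unitAddTorus
  have h1 : m * volume.real (alignedSet v e ε ∩ B) ≤ ∫ x in alignedSet v e ε ∩ B, torusStrainTopEig v x := by
    have hc : ∫ _ in alignedSet v e ε ∩ B, m = volume.real (alignedSet v e ε ∩ B) * m := by
      rw [setIntegral_const, smul_eq_mul]
    rw [mul_comm, ← hc]
    exact setIntegral_mono_on (integrableOn_const (hs := by finiteness)) hLi.integrableOn (hAm.inter hB)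
      fun x hx => hm x hx.2
  have h2 : ∫ x in alignedSet v e ε ∩ B, torusStrainTopEig v x ≤
      ∫ x in alignedSet v e ε, torusStrainTopEig v x :=
    setIntegral_mono_set hLi.integrableOn
      (ae_of_all _ fun x => torusStrainTopEig_nonneg (d := Fin 3) (by simp) hv hdiv x)
      (ae_of_all _ fun x hx => hx.1)
  have h3 := spread hv hdiv he ε
  rw [← topEigMoment_one_eq_integral hv hdiv] at h3
  have h4 : (3 - ε) * (m * volume.real (alignedSet v e ε ∩ B)) ≤
      (3 - ε) * ∫ x in alignedSet v e ε, torusStrainTopEig v x :=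
    mul_le_mul_of_nonneg_left (h1.trans h2) (sub_nonneg.mpr hε)
  exact h4.trans h3

/-! ## 5. Fixed-axis rigidity -/

/-- **FIXED-AXIS RIGIDITY.** If one fixed unit direction `e` is `ε`-aligned with the top frame
EVERYWHERE (`(1 − ε) λ₁ ≤ eᵀSe` on all of `T³`) for some `ε < 1`, then `Φ₁(v) = 0` (so `λ₁ ≡ 0`
a.e., `S ≡ 0`): no non-trivial smooth divergence-free field on `T³` keeps its top strain
eigen-direction uniformly close to a fixed axis. [ours] -/
theorem moment_one_eq_zero_of_aligned_everywhere (hv : Torus.IsSmooth v) (hdiv : Torus.IsDivFree v)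
    {e : Fin 3 → ℝ} (he : e ⬝ᵥ e = 1) {ε : ℝ} (hε : ε < 1)
    (h : ∀ x, (1 - ε) * torusStrainTopEig v x ≤ ∑ i, ∑ j, e i * torusStrainMatrix v x i j * e j) :
    torusTopEigMoment 1 v = 0 := by
  have hs := spread hv hdiv he ε
  have huniv : alignedSet v e ε = Set.univ := Set.eq_univ_of_forall fun x => h x
  rw [huniv, setIntegral_univ, ← topEigMoment_one_eq_integral hv hdiv] at hs
  have h0 : 0 ≤ torusTopEigMoment 1 v := torusTopEigMoment_nonneg 1 v
  nlinarith

end FrameSpread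

end TopEig

end Summit.NavierStokesRegularity.FunctionalMining
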